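import Literature.AlgebraicTopology.Homotopy.SerreExactSequence
import Literature.AlgebraicTopology.Homotopy.PathFibration
import Literature.AlgebraicTopology.Homotopy.HomologyWeakEquivalence
import Literature.AlgebraicTopology.SingularHomology.HurewiczTheoremProofs
import Literature.AlgebraicTopology.FundamentalGroup.SphereCoreComplementPi1
import HarnessLib

/-!
# Homology of the path fibration: `Hₙ(PY, ΩY) ≅ Hₙ(Y, y₀)` and `Hₙ(ΩY) ≅ Hₙ₊₁(Y)` in the stable range

Topic `Literature/AlgebraicTopology/Homotopy`. J.-P. Serre, *Homologie singulière des espaces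
fibrés. Applications*, Ann. of Math. 54 (1951), Ch. IV §5 Prop. 11 with Cor. 2 ("la suspension"):
for a simply connected space `Y` with `πᵢ(Y) = 0` for `i < m` (`m ≥ 2`), the path fibration
`ΩY → PY → Y` has `(m-2)`-connected fibre and contractible total space, so the Serre exact
sequence gives `Hₙ(PY, ΩY) ≅ Hₙ(Y, y₀)` for `n < 2m - 1` and hence the **homology suspension**
`Hₙ(ΩY; ℤ) ≅ Hₙ₊₁(Y; ℤ)` for `1 ≤ n ≤ 2m - 3` (G. W. Whitehead, *Elements of Homotopy Theory*,
VIII (7.13); A. Hatcher, *Algebraic Topology* (2002), §4.3 p. 408 and the spectral-sequences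
chapter, Example 5.12). Here for `Y` a Hausdorff CW complex with one `0`-cell `y₀` and no cells
of dimension `1, …, m-1` (so that `SerreExactSequence.lean` applies), simply connected with
`π_k(Y) = 0` for `2 ≤ k < m`:

* `PathFibre.pathConnectedSpace`, `subsingleton_pi`, `simplyConnectedSpace`,
  `isZero_singularHomology` — the fibres `{paths y₀ ⇝ x}` of `PY → Y` are path-connected,
  `π_k(fibre) ≅ π_{k+1}(Y)` vanishes for `k + 1 < m`, and (Hurewicz) `H_k(fibre; ℤ) = 0` for
  `0 < k < m - 1`;
* `PathFibre.isIso_map_endPt` — **`(endPt)_* : Hₙ(PY, ΩY; ℤ) ≅ Hₙ(Y, y₀; ℤ)` for `n < 2m - 1`**;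
* `PathFibre.isIso_δ` — `∂ : Hₙ₊₁(PY, ΩY) ≅ Hₙ(ΩY)` for `n ≥ 1` (`PY` contractible);
* `PathFibre.isIso_ofAbsolute` — `Hₙ(Y) ≅ Hₙ(Y, y₀)` for `n ≥ 1`.

Everything is proved; no named facts (the Hurewicz theorem used is the tree's proved
`hurewicz_isZero_holds`).

## References

* J.-P. Serre, *Homologie singulière des espaces fibrés. Applications*, Ann. of Math. (2) 54
  (1951), 425–505, Ch. IV §5 Prop. 11, Cor. 2. [Serre1951]
* A. Hatcher, *Algebraic Topology*, CUP (2002), §4.3 p. 408 (path fibration), Thm. 4.32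
  (Hurewicz), Prop. 4.66. [HatcherAT2002]
-/

noncomputable section

open Set Function Metric unitInterval CategoryTheory CategoryTheory.Limits
open scoped Topology unitInterval Topology.Homotopy
open Literature.AlgebraicTopology.SingularHomology

namespace Literature.AlgebraicTopology.Homotopy

universe u

namespace PathFibre

variable {Y : Type u} [TopologicalSpace Y] {y₀ : Y}

/-! ### The fibres `F_x = {paths from y₀ to x}` of `endPt : PY → Y` -/

variable (y₀) in
/-- The fibre of the path fibration over `x`: paths in `Y` from `y₀` to `x`. [cite: HatcherAT2002, §4.3 p. 408] -/
abbrev F (x : Y) : Type u := ↥((MappingPath.endPt : PathSpace Y y₀ → Y) ⁻¹' {x})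

/-- A path from `y₀` to `x` as a point of the fibre over `x`. [folklore] -/
def ofPath {x : Y} (γ : Path y₀ x) : F y₀ x :=
  ⟨⟨(PUnit.unit, (γ : C(I, Y))), γ.source⟩, γ.target⟩

/-- A point of the fibre over `x` as a path from `y₀` to `x`. [folklore] -/
def toPath {x : Y} (z : F y₀ x) : Path y₀ x where
  toContinuousMap := z.1.path
  source' := z.1.path_zero
  target' := z.2

/-- The formula for `toPath`. [folklore] -/
@[simp] theorem toPath_apply {x : Y} (z : F y₀ x) (s : I) : toPath z s = z.1.path s := rfl

/-- **The fibres of the path fibration of a simply connected space are path-connected** (two paths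
`y₀ ⇝ x` are homotopic rel end points; the homotopy is a path in the fibre). [cite: HatcherAT2002, §4.3 p. 408] -/
theorem pathConnectedSpace [SimplyConnectedSpace Y] (x : Y) : PathConnectedSpace (F y₀ x) := by
  haveI : PathConnectedSpace Y := inferInstance
  refine ⟨⟨ofPath (PathConnectedSpace.somePath y₀ x)⟩, fun z z' => ?_⟩
  obtain ⟨H⟩ : (toPath z).Homotopic (toPath z') := (simply_connected_iff_paths_homotopic'.1 inferInstance).2 _ _
  have h0 : ∀ t : I, H.toHomotopy.curry t 0 = y₀ := fun t => by
    show H (t, 0) = y₀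
    rw [H.eq_fst t (by simp : (0 : I) ∈ ({0, 1} : Set I))]
    exact (toPath z).source
  have h1 : ∀ t : I, H.toHomotopy.curry t 1 = x := fun t => by
    show H (t, 1) = x
    rw [H.eq_fst t (by simp : (1 : I) ∈ ({0, 1} : Set I))]
    exact (toPath z).target
  let c : I → F y₀ x := fun t => ⟨⟨(PUnit.unit, H.toHomotopy.curry t), h0 t⟩, h1 t⟩
  have hc : Continuous c :=
    ((continuous_const.prodMk H.toHomotopy.curry.continuous).subtype_mk _).subtype_mk _
  refine ⟨⟨⟨c, hc⟩, ?_, ?_⟩⟩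
  · show c 0 = z
    apply Subtype.ext; apply MappingPath.ext
    · rfl
    · ext s
      show H (0, s) = z.1.path s
      rw [H.apply_zero]; rfl
  · show c 1 = z'
    apply Subtype.ext; apply MappingPath.ext
    · rfl
    · ext s
      show H (1, s) = z'.1.path s
      rw [H.apply_one]; rfl

/-- **`π_k(F_x) ≅ π_{k+1}(Y)` vanishes when `π_{k+1}(Y)` does** (`k ≥ 1`): the connecting
bijection of the path fibration, whose total space has trivial homotopy groups.
[cite: HatcherAT2002, §4.3 p. 408 and Prop. 4.66] -/
theorem subsingleton_pi {x : Y} (k : ℕ) (hk : 1 ≤ k) (hY : ∀ y : Y, Subsingleton (π_ (k + 1) Y y))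
    (z : F y₀ x) : Subsingleton (π_ k (F y₀ x) z) := by
  have hP := PathSpace.isSerreFibration_endPt (Y := Y) y₀
  haveI : Nonempty (Fin (k + 1)) := ⟨0⟩
  haveI : Nonempty { j : Fin (k + 1) // j ≠ 0 } := ⟨⟨⟨1, by omega⟩, by simp [Fin.ext_iff]⟩⟩
  -- the connecting map at the base point `z.1 ∈ PY` is a bijection from a subsingleton
  have hb := IsSerreFibration.bijective_delta_of_subsingleton hP (N := Fin (k + 1)) (0 : Fin (k + 1)) z.1
    inferInstance inferInstance
  haveI : Subsingleton (HomotopyGroup (Fin (k + 1)) Y (MappingPath.endPt z.1)) := hY _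
  haveI hS : Subsingleton (HomotopyGroup { j : Fin (k + 1) // j ≠ 0 } ↥(fibre MappingPath.endPt z.1)
      (fibreBase MappingPath.endPt z.1)) :=
    ⟨fun a b => by obtain ⟨a', rfl⟩ := hb.2 a; obtain ⟨b', rfl⟩ := hb.2 b; rw [Subsingleton.elim a' b']⟩
  -- identify `fibre endPt z.1 = endPt⁻¹{endPt z.1}` with `F_x` (`endPt z.1 = x`) and reindex
  have hz : MappingPath.endPt z.1 = x := z.2
  let e : ↥(fibre MappingPath.endPt z.1) ≃ₜ F y₀ x := Homeomorph.setCongr (by rw [fibre, hz])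
  have hbe := bijective_homotopyGroupMap_homeomorph (N := { j : Fin (k + 1) // j ≠ 0 }) e (fibreBase MappingPath.endPt z.1)
  have hez : e (fibreBase MappingPath.endPt z.1) = z := Subtype.ext rfl
  haveI : Subsingleton (HomotopyGroup { j : Fin (k + 1) // j ≠ 0 } (F y₀ x) z) := by
    rw [← hez]
    exact ⟨fun a b => by obtain ⟨a', rfl⟩ := hbe.2 a; obtain ⟨b', rfl⟩ := hbe.2 b; rw [Subsingleton.elim a' b']⟩
  let ι : { j : Fin (k + 1) // j ≠ 0 } ≃ Fin k :=
    { toFun := fun j => j.1.pred j.2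
      invFun := fun i => ⟨i.succ, Fin.succ_ne_zero i⟩
      left_inv := fun j => Subtype.ext (Fin.succ_pred j.1 j.2)
      right_inv := fun i => Fin.pred_succ i }
  exact (homotopyGroupCongr (X := F y₀ x) (x := z) ι).symm.subsingleton

/-- **The fibres are simply connected when `π₂(Y) = 0`.** [cite: HatcherAT2002, §4.3 p. 408] -/
theorem simplyConnectedSpace [SimplyConnectedSpace Y] (x : Y) (hY : ∀ y : Y, Subsingleton (π_ 2 Y y)) :
    SimplyConnectedSpace (F y₀ x) := by
  haveI := pathConnectedSpace (y₀ := y₀) x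
  obtain ⟨z₀⟩ := (inferInstance : Nonempty (F y₀ x))
  haveI : Subsingleton (π_ 1 (F y₀ x) z₀) := subsingleton_pi 1 le_rfl hY z₀
  haveI : Subsingleton (FundamentalGroup (F y₀ x) z₀) :=
    (homotopyGroupEquivFundamentalGroupOfUnique (X := F y₀ x) (x := z₀) (Fin 1)).symm.subsingleton
  exact Literature.AlgebraicTopology.FundamentalGroup.VanKampen.simplyConnectedSpace_of_subsingleton z₀

/-- **`H_k(F_x; ℤ) = 0` for `0 < k < m - 1`** when `Y` is simply connected with `π_k(Y) = 0` for
`2 ≤ k < m` (Hurewicz on the `(m-2)`-connected fibre). [cite: HatcherAT2002, Thm. 4.32; §4.3 p. 408] -/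
theorem isZero_singularHomology [SimplyConnectedSpace Y] {m : ℕ}
    (hπ : ∀ (k : ℕ) (y : Y), 2 ≤ k → k < m → Subsingleton (π_ k Y y)) (x : Y) {k : ℕ}
    (hk0 : 0 < k) (hk : k < m - 1) : IsZero (singularHomology ℤ ℤ (F y₀ x) k) := by
  have hm : 3 ≤ m := by omega
  haveI := simplyConnectedSpace (y₀ := y₀) x (fun y => hπ 2 y le_rfl (by omega))
  refine hurewicz_isZero_holds (F y₀ x) (m - 1) (by omega) (fun j hj hjm z => ?_) k hk0 hk
  exact subsingleton_pi j (by omega) (fun y => hπ (j + 1) y (by omega) (by omega)) z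

/-! ### The theorem -/

open _root_.Topology RelCWComplex

/-- **Serre's exact sequence for the path fibration** (Serre 1951, IV §5 Prop. 11): for a simply
connected Hausdorff CW complex `Y` with one `0`-cell `y₀`, no cells of dimension `1, …, m-1`
(`m ≥ 2`) and `π_k(Y) = 0` for `2 ≤ k < m`,
`(endPt)_* : Hₙ(PY, ΩY; ℤ) → Hₙ(Y, y₀; ℤ)` is an isomorphism for `n < 2m - 1`.
[cite: Serre1951, Ch. IV §5 Prop. 11] -/
theorem isIso_map_endPt [T2Space Y] [CWComplex (univ : Set Y)] [SimplyConnectedSpace Y]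
    (h0 : ∀ y : Y, y ∈ SerreSkeleta.skel Y 0 ↔ y = y₀) {m : ℕ} (hm : 2 ≤ m)
    (hcells : ∀ k, 1 ≤ k → k < m → IsEmpty (cell (univ : Set Y) k))
    (hπ : ∀ (k : ℕ) (y : Y), 2 ≤ k → k < m → Subsingleton (π_ k Y y)) {n : ℕ} (hn : n < 2 * m - 1) :
    IsIso (relativeSingularHomology.map ℤ ℤ (SerreExact.proj (PathSpace.isSerreFibration_endPt y₀))
      (Set.mapsTo_preimage MappingPath.endPt ({y₀} : Set Y)) n) :=
  SerreExact.isIso_map ℤ (PathSpace.isSerreFibration_endPt y₀) h0 (m := m) (r := m - 1) (by omega) hcells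
    (fun x => pathConnectedSpace x) (fun x k hk0 hk => isZero_singularHomology hπ x hk0 hk) (by omega)

/-- The same, surjectivity at the edge `n ≤ 2m - 1`. [cite: Serre1951, Ch. IV §5 Prop. 11] -/
theorem epi_map_endPt [T2Space Y] [CWComplex (univ : Set Y)] [SimplyConnectedSpace Y]
    (h0 : ∀ y : Y, y ∈ SerreSkeleta.skel Y 0 ↔ y = y₀) {m : ℕ} (hm : 2 ≤ m)
    (hcells : ∀ k, 1 ≤ k → k < m → IsEmpty (cell (univ : Set Y) k))
    (hπ : ∀ (k : ℕ) (y : Y), 2 ≤ k → k < m → Subsingleton (π_ k Y y)) {n : ℕ} (hn : n ≤ 2 * m - 1) :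
    Epi (relativeSingularHomology.map ℤ ℤ (SerreExact.proj (PathSpace.isSerreFibration_endPt y₀))
      (Set.mapsTo_preimage MappingPath.endPt ({y₀} : Set Y)) n) :=
  SerreExact.epi_map ℤ (PathSpace.isSerreFibration_endPt y₀) h0 (m := m) (r := m - 1) (by omega) hcells
    (fun x => pathConnectedSpace x) (fun x k hk0 hk => isZero_singularHomology hπ x hk0 hk) (by omega)

/-- **Serre's exact sequence for the path fibration over a base whose low skeleton is weakly
contractible** (e.g. a mapping telescope of CW complexes): `y₀ ∈ Yˢ⁰`, `{y₀} ↪ Yˢ⁰` a weak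
homotopy equivalence, `s₀ + 1 ≥ m ≥ 2`, `Y` simply connected with `π_k(Y) = 0` for `2 ≤ k < m`:
`(endPt)_* : Hₙ(PY, ΩY; ℤ) ≅ Hₙ(Y, y₀; ℤ)` for `n < 2m - 1`. [cite: Serre1951, Ch. IV §5 Prop. 11] -/
theorem isIso_map_endPt_of_isWeakHomotopyEquiv [T2Space Y] [CWComplex (univ : Set Y)] [SimplyConnectedSpace Y]
    (s₀ : ℕ) {m : ℕ} (hm : 2 ≤ m) (hms : m ≤ s₀ + 1) (hb : y₀ ∈ SerreSkeleta.skel Y s₀)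
    (hw : IsWeakHomotopyEquiv (subsetInclusion (singleton_subset_iff.2 hb)))
    (hπ : ∀ (k : ℕ) (y : Y), 2 ≤ k → k < m → Subsingleton (π_ k Y y)) {n : ℕ} (hn : n < 2 * m - 1) :
    IsIso (relativeSingularHomology.map ℤ ℤ (SerreExact.proj (PathSpace.isSerreFibration_endPt y₀))
      (Set.mapsTo_preimage MappingPath.endPt ({y₀} : Set Y)) n) :=
  SerreExact.isIso_map_of_isWeakHomotopyEquiv ℤ (PathSpace.isSerreFibration_endPt y₀) s₀ (m := m) (r := m - 1)
    hms hb hw (by omega) (fun x => pathConnectedSpace x) (fun x k hk0 hk => isZero_singularHomology hπ x hk0 hk) (by omega)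

/-- The same, surjectivity at the edge `n ≤ 2m - 1`. [cite: Serre1951, Ch. IV §5 Prop. 11] -/
theorem epi_map_endPt_of_isWeakHomotopyEquiv [T2Space Y] [CWComplex (univ : Set Y)] [SimplyConnectedSpace Y]
    (s₀ : ℕ) {m : ℕ} (hm : 2 ≤ m) (hms : m ≤ s₀ + 1) (hb : y₀ ∈ SerreSkeleta.skel Y s₀)
    (hw : IsWeakHomotopyEquiv (subsetInclusion (singleton_subset_iff.2 hb)))
    (hπ : ∀ (k : ℕ) (y : Y), 2 ≤ k → k < m → Subsingleton (π_ k Y y)) {n : ℕ} (hn : n ≤ 2 * m - 1) :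
    Epi (relativeSingularHomology.map ℤ ℤ (SerreExact.proj (PathSpace.isSerreFibration_endPt y₀))
      (Set.mapsTo_preimage MappingPath.endPt ({y₀} : Set Y)) n) :=
  SerreExact.epi_map_of_isWeakHomotopyEquiv ℤ (PathSpace.isSerreFibration_endPt y₀) s₀ (m := m) (r := m - 1)
    hms hb hw (by omega) (fun x => pathConnectedSpace x) (fun x k hk0 hk => isZero_singularHomology hπ x hk0 hk) (by omega)

/-! ### The two ends: `Hₙ₊₁(PY, ΩY) ≅ Hₙ(ΩY)` and `Hₙ(Y) ≅ Hₙ(Y, y₀)` -/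

/-- The homology of the (contractible) path space vanishes in positive degrees. [cite: HatcherAT2002, §4.3 p. 408] -/
theorem isZero_singularHomology_pathSpace (R : Type u) [CommRing R] {n : ℕ} (hn : n ≠ 0) :
    IsZero (singularHomology R R (PathSpace Y y₀) n) := by
  obtain ⟨e⟩ := ContractibleSpace.hequiv_unit (PathSpace Y y₀)
  let e' : ContinuousMap.HomotopyEquiv (PathSpace Y y₀) (ULift.{u} Unit) :=
    e.trans Homeomorph.ulift.symm.toHomotopyEquiv
  exact (isZero_singularHomology_of_subsingleton R R (X := ULift.{u} Unit) hn).of_iso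
    (singularHomology.isoOfHomotopyEquiv R R e' n)

/-- **`∂ : Hₙ₊₁(PY, ΩY) ≅ Hₙ(ΩY)` for `n ≥ 1`** (`PY` is contractible; long exact sequence of the
pair). [cite: HatcherAT2002, Thm. 2.16; §4.3 p. 408] -/
theorem isIso_δ (R : Type u) [CommRing R] {n : ℕ} (hn : 1 ≤ n) :
    IsIso (relativeSingularHomology.δ R R (PathSpace Y y₀)
      ((MappingPath.endPt : PathSpace Y y₀ → Y) ⁻¹' {y₀}) n) := by
  have h₁ := isZero_singularHomology_pathSpace (y₀ := y₀) R (n := n + 1) (Nat.succ_ne_zero n)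
  have h₀ := isZero_singularHomology_pathSpace (y₀ := y₀) R (n := n) (by omega)
  haveI : Mono (relativeSingularHomology.δ R R (PathSpace Y y₀) ((MappingPath.endPt : PathSpace Y y₀ → Y) ⁻¹' {y₀}) n) :=
    (relativeSingularHomology.exact_ofAbsolute_δ R R (X := PathSpace Y y₀) _ n).mono_g (h₁.eq_of_src _ _)
  haveI : Epi (relativeSingularHomology.δ R R (PathSpace Y y₀) ((MappingPath.endPt : PathSpace Y y₀ → Y) ⁻¹' {y₀}) n) :=
    (relativeSingularHomology.exact_δ_map R R (X := PathSpace Y y₀) _ n).epi_f (h₀.eq_of_tgt _ _)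
  exact isIso_of_mono_of_epi _

/-- **`Hₙ(Y) ≅ Hₙ(Y, y₀)` for `n ≥ 1`** and `Y` path-connected (long exact sequence of the pair
`(Y, y₀)`). [cite: HatcherAT2002, Thm. 2.16, Prop. 2.22 (reduced homology)] -/
theorem isIso_ofAbsolute (R : Type u) [CommRing R] [PathConnectedSpace Y] (y : Y) {n : ℕ} (hn : 1 ≤ n) :
    IsIso (relativeSingularHomology.ofAbsolute R R Y ({y} : Set Y) n) := by
  haveI : Subsingleton ↥({y} : Set Y) := ⟨fun a b => Subtype.ext (a.2.trans b.2.symm)⟩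
  haveI : PathConnectedSpace ↥({y} : Set Y) := isPathConnected_iff_pathConnectedSpace.1 (isPathConnected_singleton y)
  have hpt : ∀ j, j ≠ 0 → IsZero (singularHomology R R ↥({y} : Set Y) j) := fun j hj =>
    isZero_singularHomology_of_subsingleton R R hj
  haveI : Mono (relativeSingularHomology.ofAbsolute R R Y ({y} : Set Y) n) :=
    (relativeSingularHomology.exact_map_ofAbsolute R R (X := Y) {y} n).mono_g ((hpt n (by omega)).eq_of_src _ _)
  haveI : Epi (relativeSingularHomology.ofAbsolute R R Y ({y} : Set Y) n) := by
    obtain ⟨k, rfl⟩ : ∃ k, n = k + 1 := ⟨n - 1, by omega⟩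
    refine (relativeSingularHomology.exact_ofAbsolute_δ R R (X := Y) {y} k).epi_f ?_
    -- `δ : H_{k+1}(Y, y) → H_k({y})` vanishes: `H_k({y}) → H_k(Y)` is injective
    haveI : Mono (singularHomology.map R R (⟨Subtype.val, continuous_subtype_val⟩ : C(↥({y} : Set Y), Y)) k) := by
      cases k with
      | zero =>
        haveI := singularHomology.isIso_map_zero_of_pathConnectedSpace R R
          (⟨Subtype.val, continuous_subtype_val⟩ : C(↥({y} : Set Y), Y))
        infer_instance
      | succ k => exact (hpt (k + 1) (Nat.succ_ne_zero k)).mono _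
    exact zero_of_comp_mono _ (relativeSingularHomology.δ_comp_map R R (X := Y) {y} k)
  exact isIso_of_mono_of_epi _

end PathFibre

end Literature.AlgebraicTopology.Homotopy

end
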